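import Literature.AlgebraicGeometry.Morphisms.CechUnitCocycleResidueFibreClass
import Mathlib.Topology.Sheaves.SheafCondition.UniqueGluing
import HarnessLib

/-!
# Stein in the models: a Čech `0`-cocycle of the models `Γ(U_i) ⊗_A R` of `X ×_A Spec R` is a constant of `R` when
# `R → Γ(X ×_A Spec R, 𝒪)` is surjective (Görtz–Wedhorn II, Lemma 24.72 (∗) / Cor. 24.63)

Layer `Literature/AlgebraicGeometry/Morphisms`, namespace `Literature.AlgebraicGeometry.Morphisms.CechUnitCocycle`.
THEOREMS ONLY (no definition, no named fact, no instance, no notation).  Cell `hodgecm-mathlib` (D-0151), F-2d road (R-def)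
«theorem of the cube over a NON-reduced base by Artinian induction», brick Č4d (author B-p07 (g16)): the discharge of the STEIN
hypotheses `hSt_m` of ★ Č4c `exists_rel_of_rel_map_of_rel_faces` / ★ Č4c′ `forall_exists_rel_of_tower` from the scheme-level
statement «`R → Γ(Z, 𝒪_Z)` is surjective» for `Z = Y ×_A Spec R` ([GortzWedhorn2023] Lemma 24.72, (∗): «`H⁰(Y × Spec A, 𝒪) = A`
for every local Artinian algebra `A`», Cor. 24.63; for abelian schemes ★ `AbelianSchemeSteinOfNoetherian.baseChange_app_bijective`,
in the `toSectionsBase` currency of ★ `SteinOfArtinianBase.bijective_toSectionsBase_iff_bijective_appTop`).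

For the cartesian square `Z = X ×_A Spec R` (`g : Z → X`, `fZ : Z → Spec R`, ★ `IsPullback`) and a cover `𝒰` of `X` by affine
opens: a family `c_i ∈ Γ(U_i) ⊗_A R` with `c_i| = c_j|` in `Γ(U_i ∩ U_j) ⊗_A R` is read through the affine dictionary ★
`bcSections` (Č2 §1) as sections of `𝒪_Z` on `g⁻¹U_i` agreeing on overlaps, glued (Mathlib `TopCat.Sheaf.existsUnique_gluing'`)
to a global section, which is `f_Z^*(r)` by Stein; reading back through the injective dictionary gives `c_i = 1 ⊗ r`.

* `res_toSectionsBase_eq`, `bcSections_comm_one_tmul` — `f_Z^*(r)|_W` and the model map on `1 ⊗ r`;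
* **`exists_eq_one_tmul_of_surjective_toSectionsBase`** — the statement above;
* **`exists_eq_one_tmul_units_of_surjective_toSectionsBase`** — its unit-cochain form (= `hSt` of Č4c verbatim).

HC_CM is proved only modulo the 7 printed citations until rung 0 closes; nothing here is about HC.

## References
* [GortzWedhorn2023] U. Görtz, T. Wedhorn, *Algebraic Geometry II* (2023), Lemma 24.72 proof Step (I) and (∗) (p. 409),
  Cor. 24.63 (p. 404).
* [StacksProject] The Stacks Project, Tag 02KG (Cohomology of Schemes, Lemma 30.5.1), Tag 01ED (Čech cohomology).
-/

noncomputable section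

universe u v

open TensorProduct CategoryTheory AlgebraicGeometry Opposite TopologicalSpace

namespace Literature.AlgebraicGeometry.Morphisms

namespace CechUnitCocycle

variable {A : Type u} [CommRing A] {X : Scheme.{u}} {f : X ⟶ Spec (.of A)} {ι : Type v} {U : ι → X.Opens}
variable {R : Type u} [CommRing R] [Algebra A R] {Z : Scheme.{u}} {fZ : Z ⟶ Spec (.of R)} {g : Z ⟶ X}

/-- `f_Z^*(r)|_W` restricted to `W' ⊆ W` is `f_Z^*(r)|_{W'}` (★ `toSectionsBase` is compatible with restriction: the restriction
maps of `𝒪_Z` are `R`-linear). [cite: StacksProject, Tag 02KG] -/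
theorem res_toSectionsBase_eq {W W' : Z.Opens} (h : W' ≤ W) (r : R) :
    Sections.res (restrictBase A fZ) h (toSectionsBase A fZ W r) = toSectionsBase A fZ W' r :=
  (Sections.res fZ h).commutes r

/-- **The model map on a constant**: `(1 ⊗ r)^Z|_W = f_Z^*(r)|_W` (★ `bcSections_comm_tmul` with `g^*(1) = 1`).
[cite: StacksProject, Tag 02KG] -/
theorem bcSections_comm_one_tmul (hg : g ≫ f = restrictBase A fZ) {V : X.Opens} {W : Z.Opens} (e : W ≤ g ⁻¹ᵁ V) (r : R) :
    (bcSections f fZ g hg e).comp (Algebra.TensorProduct.comm A (Sections f V) R).toAlgHom ((1 : Sections f V) ⊗ₜ[A] r) =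
      toSectionsBase A fZ W r := by
  rw [bcSections_comm_tmul, map_one, mul_one]

/-- **STEIN IN THE MODELS** ([GortzWedhorn2023] Lemma 24.72 (∗) «`H⁰(Y × Spec A, 𝒪_{Y × Spec A}) = A`», Čech-model form): for
the cartesian square `Z = X ×_A Spec R` and a cover `𝒰` of `X` by AFFINE opens, if `R → Γ(Z, 𝒪_Z)`, `r ↦ f_Z^*(r)`, is
surjective, then every family `c_i ∈ Γ(U_i) ⊗_A R` with `c_i|_{U_i ∩ U_j} = c_j|_{U_i ∩ U_j}` for all `i, j` is CONSTANT:
`c_i = 1 ⊗ r` for one `r ∈ R` (glue the sections `c_i^Z ∈ Γ(Z, g⁻¹U_i)` to a global section `= f_Z^*(r)` and read back through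
the injective affine dictionary). [cite: GortzWedhorn2023, Lemma 24.72 proof Step (I) and (∗) (p. 409)]
[cite: StacksProject, Tag 01ED (Cohomology, Section 20.9)] -/
theorem exists_eq_one_tmul_of_surjective_toSectionsBase
    (HP : IsPullback g fZ f (Spec.map (CommRingCat.ofHom (algebraMap A R)))) (hU : ∀ i, IsAffineOpen (U i))
    (hcov : ⨆ i, U i = ⊤) (hSt : Function.Surjective (toSectionsBase A fZ ⊤))
    (c : (i : ι) → Sections f (U i) ⊗[A] R)
    (hc : ∀ i j, resR f R (inf_le_left : U i ⊓ U j ≤ U i) (c i) = resR f R (inf_le_right : U i ⊓ U j ≤ U j) (c j)) :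
    ∃ r : R, ∀ i, c i = 1 ⊗ₜ r := by
  -- the sections `c_i^Z ∈ Γ(Z, g⁻¹U_i)` and their compatibility
  let s : ∀ i, Γ(Z, preimageFamily g U i) := fun i =>
    (bcSections f fZ g HP.w (le_refl (g ⁻¹ᵁ U i))).comp (Algebra.TensorProduct.comm A (Sections f (U i)) R).toAlgHom (c i)
  have hs : TopCat.Presheaf.IsCompatible Z.sheaf.1 (preimageFamily g U) s := by
    intro i j
    change Sections.res (restrictBase A fZ) (inf_le_left : preimageFamily g U i ⊓ preimageFamily g U j ≤ preimageFamily g U i)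
        (s i) =
      Sections.res (restrictBase A fZ) (inf_le_right : preimageFamily g U i ⊓ preimageFamily g U j ≤ preimageFamily g U j) (s j)
    rw [res_bcSections_comm HP.w (le_refl _) (fun _ hx => hx : preimageFamily g U i ⊓ preimageFamily g U j ≤ g ⁻¹ᵁ (U i ⊓ U j))
        (inf_le_left : U i ⊓ U j ≤ U i),
      res_bcSections_comm HP.w (le_refl _) (fun _ hx => hx : preimageFamily g U i ⊓ preimageFamily g U j ≤ g ⁻¹ᵁ (U i ⊓ U j))
        (inf_le_right : U i ⊓ U j ≤ U j), hc i j]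
  -- the preimages cover `Z`
  have hcov' : (⊤ : Z.Opens) ≤ ⨆ i, preimageFamily g U i := by
    change ⊤ ≤ ⨆ i, g ⁻¹ᵁ U i
    rw [← Scheme.Hom.preimage_iSup, hcov, Scheme.Hom.preimage_top]
  -- glue, and recognise the global section as `f_Z^*(r)`
  obtain ⟨t, ht, -⟩ := Z.sheaf.existsUnique_gluing' (preimageFamily g U) ⊤ (fun i => homOfLE le_top) hcov' s hs
  obtain ⟨r, hr⟩ := hSt t
  refine ⟨r, fun i => (bcSections_comm_bijective HP (hU i)).1 ?_⟩
  change s i = _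
  rw [bcSections_comm_one_tmul HP.w (le_refl _) r, ← res_toSectionsBase_eq (le_top : preimageFamily g U i ≤ ⊤) r, hr, ← ht i]
  rfl

/-- **STEIN IN THE MODELS, unit-cochain form** — verbatim the hypothesis `hSt_m` of ★ Č4c `exists_rel_of_rel_map_of_rel_faces` and
★ Č4c′ `forall_exists_rel_of_tower` (there for a face `Y_m → Spec A` and its base change `Y_m ×_A Spec R_n`): a Čech `0`-cocycle
of units of the models is a constant of `R`. [cite: GortzWedhorn2023, Lemma 24.72 proof Step (I) and (∗) (p. 409)] -/
theorem exists_eq_one_tmul_units_of_surjective_toSectionsBase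
    (HP : IsPullback g fZ f (Spec.map (CommRingCat.ofHom (algebraMap A R)))) (hU : ∀ i, IsAffineOpen (U i))
    (hcov : ⨆ i, U i = ⊤) (hSt : Function.Surjective (toSectionsBase A fZ ⊤)) (c : UCochain0 f U R)
    (hc : ∀ i j, resR f R (inf_le_left : U i ⊓ U j ≤ U i) (c i : Sections f (U i) ⊗[A] R) =
      resR f R (inf_le_right : U i ⊓ U j ≤ U j) (c j : Sections f (U j) ⊗[A] R)) :
    ∃ r : R, ∀ i, (c i : Sections f (U i) ⊗[A] R) = 1 ⊗ₜ r :=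
  exists_eq_one_tmul_of_surjective_toSectionsBase HP hU hcov hSt (fun i => (c i : Sections f (U i) ⊗[A] R)) hc

end CechUnitCocycle

end Literature.AlgebraicGeometry.Morphisms

end
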